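import Literature.MathematicalPhysics.QuantumLattice.WilsonFermionGramRegularity
import Literature.MathematicalPhysics.QuantumFieldTheory.ConstructiveQFTWave0OddRPProofs
import Summits.QuantumFields.QCD.Theorems.HeatSlicedQuarksInterleavedFlowProperStubFineWeightAdmissibleOddTransfer
import HarnessLib

/-!
# Fine-weight admissibility, part 3: slice data of the antiperiodic Wilson–Dirac operator under
the link reflection, the crossing-link split and the splice
(crux stmt-QuantumFields-18031 `HeatSlicedQuarks.InterleavedFlowProper`, line `Sketch`,
stub `stub_fineWeightAdmissible`, clause (6))

For an `SU(N)` lattice gauge field `U` on the four-torus `(ℤ/(n+1))⁴` the tree writes the `r = 1`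
antiperiodic Wilson–Dirac operator `D_AP[U, m]` (`wilsonDiracAP`) as the Wilson block matrix of
the slice data `a_t = sliceDiag`, `b_t = sliceOff` (spatial blocks of the slice `t`, built from the
antiperiodic lift `apLift U`) and `w_t = sliceLink` (temporal links of the layer `t → t + 1`,
built from `unitaryLift U`), and proves Lüscher's transfer-matrix formula for it
(`WilsonDiracSliceBlocks`, `WilsonBlockDeterminant`). This file records how the slice data
transform under the three operations of the ODD-torus link-reflection positivity mechanism of
`ConstructiveQFTWave0OddRPProofs` (reflection `θ t = 1 - t`, crossing layer `0 → 1`):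

* the link reflection `GaugeConfig.timeReflect`: `a_t[ΘU] = a_{1-t}[U]`, `b_t[ΘU] = b_{1-t}[U]`,
  `w_t[ΘU] = (w_{-t}[U])ᴴ` (`sliceDiag_timeReflect`, `sliceOff_timeReflect`,
  `sliceLink_timeReflect`);
* the Osterwalder–Seiler split `translateLow Y U` (`U_e ↦ U_e Y_e` on the crossing layer): the
  spatial blocks are unchanged, `w_0` becomes `w_0[U] · w_0[Y]`, the other `w_t` are unchanged;
* the splice `splice lowerEdges (U, Y)` (crossing links from `Y`): spatial blocks unchanged,
  `w_0 = w_0[Y]`, the other `w_t` unchanged;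

together with the transfer-matrix formula on a torus of arbitrary side `n + 1`
(`fermionDet_wilsonDiracAP_eq_transfer'`, the tree's `fermionDet_wilsonDiracAP_eq_transfer`
being stated for even sides only). All statements are proved; no definitions.

References: M. Lüscher, Commun. Math. Phys. 54 (1977) 283, §3; K. Osterwalder, E. Seiler,
Ann. Phys. 110 (1978) 440, §2; I. Montvay, G. Münster, *Quantum Fields on a Lattice* (1994) §4.2.3.
-/

noncomputable section

-- The time-slice index types (`((κ × Fin 2) ⊕ (κ × Fin 2)) × Fin (n+1)`) are too deep for the
-- default instance-search size bound (`DecidableEq`, needed by `Matrix.det`), as in the tree's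
-- `WilsonDiracSliceBlocks`.
set_option synthInstance.maxSize 512

namespace Summit.QuantumFields.QCD.Cruxes.InterleavedFlowProper.OffsetLastFormatHandover

namespace FineWeight

open Literature.MathematicalPhysics.QuantumFieldTheory Literature.MathematicalPhysics.QuantumLattice
open Literature.Probability.LatticeModels Literature.LinearAlgebra.Matrix
open Matrix Complex Finset
open scoped Kronecker ComplexOrder

variable {n N : ℕ}

/-! ## The link reflection on slice sites and slice links -/

/-- The link reflection `θ (t, y) = (1 - t, y)` on slice sites. -/
theorem timeReflect_sliceSite (t : Fin (n + 1)) (y : Fin 3 → ZMod (n + 1)) :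
    Site.timeReflect (sliceSite t y) = sliceSite (1 - t) y := by
  ext i
  refine Fin.cases ?_ (fun i => ?_) i
  · simp [Site.timeReflect, sliceSite, map_sub]
  · simp [Site.timeReflect, sliceSite, Fin.succ_ne_zero]

/-- `θ ((t, y) + ê₀) = (-t, y)`. -/
theorem timeReflect_shift_sliceSite (t : Fin (n + 1)) (y : Fin 3 → ZMod (n + 1)) :
    Site.timeReflect (Site.shift (sliceSite t y) 0) = sliceSite (-t) y := by
  rw [sliceSite_shift_zero, timeReflect_sliceSite, show (1 : Fin (n + 1)) - (t + 1) = -t by abel]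

/-- Spatial slice links of the reflected field, after the antiperiodic lift:
`(ΘU)^(t, y; j) = U^(1 - t, y; j)`. -/
theorem apLift_timeReflect_sliceSite_succ (U : GaugeConfig 4 (n + 1) (Matrix.specialUnitaryGroup (Fin N) ℂ))
    (t : Fin (n + 1)) (y : Fin 3 → ZMod (n + 1)) (j : Fin 3) :
    apLift (N := N) U.timeReflect (sliceSite t y, j.succ) = apLift U (sliceSite (1 - t) y, j.succ) := by
  rw [apLift_sliceSite_succ, apLift_sliceSite_succ]
  have h : unitaryLift (N := N) U.timeReflect (sliceSite t y, j.succ) = unitaryLift U (sliceSite (1 - t) y, j.succ) := by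
    rw [unitaryLift_apply, unitaryLift_apply]
    simp only [GaugeConfig.timeReflect, Fin.succ_ne_zero, ↓reduceIte, timeReflect_sliceSite]
  rw [h]

/-- Temporal slice links of the reflected field: `(ΘU)(t, y; 0) = U(-t, y; 0)⁻¹`. -/
theorem unitaryLift_timeReflect_sliceSite_zero (U : GaugeConfig 4 (n + 1) (Matrix.specialUnitaryGroup (Fin N) ℂ))
    (t : Fin (n + 1)) (y : Fin 3 → ZMod (n + 1)) :
    unitaryLift (N := N) U.timeReflect (sliceSite t y, 0) = (unitaryLift U (sliceSite (-t) y, 0))⁻¹ := by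
  rw [unitaryLift_apply, unitaryLift_apply]
  simp only [GaugeConfig.timeReflect, ↓reduceIte, timeReflect_shift_sliceSite, map_inv]

/-- **`a_t[ΘU] = a_{1-t}[U]`.** -/
theorem sliceDiag_timeReflect (U : GaugeConfig 4 (n + 1) (Matrix.specialUnitaryGroup (Fin N) ℂ)) (m : ℝ)
    (t : Fin (n + 1)) :
    sliceDiag (unitaryFundamentalRep (Fin N) ℂ) (apLift U.timeReflect) m t =
      sliceDiag (unitaryFundamentalRep (Fin N) ℂ) (apLift U) m (1 - t) := by
  have h1 : ∀ j, sliceHop (unitaryFundamentalRep (Fin N) ℂ) (apLift U.timeReflect) t j =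
      sliceHop (unitaryFundamentalRep (Fin N) ℂ) (apLift U) (1 - t) j := fun j => by
    ext p q; simp only [sliceHop, Matrix.of_apply, apLift_timeReflect_sliceSite_succ]
  have h2 : ∀ j, sliceHop' (unitaryFundamentalRep (Fin N) ℂ) (apLift U.timeReflect) t j =
      sliceHop' (unitaryFundamentalRep (Fin N) ℂ) (apLift U) (1 - t) j := fun j => by
    ext p q; simp only [sliceHop', Matrix.of_apply, apLift_timeReflect_sliceSite_succ]
  simp only [sliceDiag, h1, h2]

/-- **`b_t[ΘU] = b_{1-t}[U]`.** -/
theorem sliceOff_timeReflect (U : GaugeConfig 4 (n + 1) (Matrix.specialUnitaryGroup (Fin N) ℂ)) (t : Fin (n + 1)) :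
    sliceOff (unitaryFundamentalRep (Fin N) ℂ) (apLift U.timeReflect) t =
      sliceOff (unitaryFundamentalRep (Fin N) ℂ) (apLift U) (1 - t) := by
  have h1 : ∀ j, sliceHop (unitaryFundamentalRep (Fin N) ℂ) (apLift U.timeReflect) t j =
      sliceHop (unitaryFundamentalRep (Fin N) ℂ) (apLift U) (1 - t) j := fun j => by
    ext p q; simp only [sliceHop, Matrix.of_apply, apLift_timeReflect_sliceSite_succ]
  have h2 : ∀ j, sliceHop' (unitaryFundamentalRep (Fin N) ℂ) (apLift U.timeReflect) t j =
      sliceHop' (unitaryFundamentalRep (Fin N) ℂ) (apLift U) (1 - t) j := fun j => by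
    ext p q; simp only [sliceHop', Matrix.of_apply, apLift_timeReflect_sliceSite_succ]
  simp only [sliceOff, h1, h2]

/-- **`w_t[ΘU] = (w_{-t}[U])ᴴ`.** -/
theorem sliceLink_timeReflect (U : GaugeConfig 4 (n + 1) (Matrix.specialUnitaryGroup (Fin N) ℂ)) (t : Fin (n + 1)) :
    sliceLink (unitaryFundamentalRep (Fin N) ℂ) (unitaryLift U.timeReflect) t =
      (sliceLink (unitaryFundamentalRep (Fin N) ℂ) (unitaryLift U) (-t))ᴴ := by
  have h : timeLink (unitaryFundamentalRep (Fin N) ℂ) (unitaryLift U.timeReflect) t =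
      (timeLink (unitaryFundamentalRep (Fin N) ℂ) (unitaryLift U) (-t))ᴴ := by
    ext ⟨y, a⟩ ⟨y', b⟩
    simp only [timeLink, Matrix.of_apply, Matrix.conjTranspose_apply, unitaryLift_timeReflect_sliceSite_zero]
    by_cases hy : y = y'
    · subst hy
      simp only [↓reduceIte]
      rw [unitaryRep_star_apply _ unitaryFundamentalRep_mem_unitaryGroup]
    · simp [hy, Ne.symm hy]
  rw [sliceLink, sliceLink, h, Matrix.conjTranspose_kronecker, Matrix.conjTranspose_one]

/-! ## The crossing-link split and the splice on slice links -/

/-- A slice link is a crossing link iff it is a temporal link of the layer `0 → 1`. -/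
theorem isLowerCross_sliceSite_iff (t : Fin (n + 1)) (y : Fin 3 → ZMod (n + 1)) (μ : Fin 4) :
    WilsonRP.IsLowerCross ((sliceSite t y, μ) : Edge 4 (n + 1)) ↔ μ = 0 ∧ t = 0 := by
  rw [WilsonRP.IsLowerCross]
  simp only [sliceSite_apply_zero]
  refine and_congr Iff.rfl ?_
  rw [ZMod.val_eq_zero, map_eq_zero_iff _ (ZMod.finEquiv (n + 1)).injective]

/-- Spatial slice links are untouched by the crossing-link split. -/
theorem translateLow_sliceSite_succ {G : Type*} [Group G] (Y U : GaugeConfig 4 (n + 1) G)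
    (t : Fin (n + 1)) (y : Fin 3 → ZMod (n + 1)) (j : Fin 3) :
    WilsonOddRP.translateLow Y U (sliceSite t y, j.succ) = U (sliceSite t y, j.succ) :=
  WilsonOddRP.translateLow_apply_of_not_isLowerCross Y U fun h =>
    Fin.succ_ne_zero j ((isLowerCross_sliceSite_iff t y j.succ).1 h).1

/-- Spatial slice links are untouched by the splice of the crossing links. -/
theorem splice_sliceSite_succ {G : Type*} (U Y : GaugeConfig 4 (n + 1) G)
    (t : Fin (n + 1)) (y : Fin 3 → ZMod (n + 1)) (j : Fin 3) :
    LatticeRP.splice WilsonOddRP.lowerEdges (U, Y) (sliceSite t y, j.succ) = U (sliceSite t y, j.succ) :=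
  WilsonOddRP.splice_apply_of_not_isLowerCross U Y fun h =>
    Fin.succ_ne_zero j ((isLowerCross_sliceSite_iff t y j.succ).1 h).1

/-- Temporal slice links off the crossing layer are untouched by the split. -/
theorem translateLow_sliceSite_zero_of_ne {G : Type*} [Group G] (Y U : GaugeConfig 4 (n + 1) G)
    {t : Fin (n + 1)} (ht : t ≠ 0) (y : Fin 3 → ZMod (n + 1)) :
    WilsonOddRP.translateLow Y U (sliceSite t y, 0) = U (sliceSite t y, 0) :=
  WilsonOddRP.translateLow_apply_of_not_isLowerCross Y U fun h => ht ((isLowerCross_sliceSite_iff t y 0).1 h).2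

/-- Temporal slice links off the crossing layer are untouched by the splice. -/
theorem splice_sliceSite_zero_of_ne {G : Type*} (U Y : GaugeConfig 4 (n + 1) G)
    {t : Fin (n + 1)} (ht : t ≠ 0) (y : Fin 3 → ZMod (n + 1)) :
    LatticeRP.splice WilsonOddRP.lowerEdges (U, Y) (sliceSite t y, 0) = U (sliceSite t y, 0) :=
  WilsonOddRP.splice_apply_of_not_isLowerCross U Y fun h => ht ((isLowerCross_sliceSite_iff t y 0).1 h).2

/-- On the crossing layer the split multiplies: `(translateLow Y U)(0, y; 0) = U(0, y; 0) · Y(0, y; 0)`. -/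
theorem translateLow_sliceSite_zero_zero {G : Type*} [Group G] (Y U : GaugeConfig 4 (n + 1) G)
    (y : Fin 3 → ZMod (n + 1)) :
    WilsonOddRP.translateLow Y U (sliceSite 0 y, 0) = U (sliceSite 0 y, 0) * Y (sliceSite 0 y, 0) :=
  WilsonOddRP.translateLow_apply_of_isLowerCross Y U ((isLowerCross_sliceSite_iff 0 y 0).2 ⟨rfl, rfl⟩)

/-- On the crossing layer the splice reads `Y`. -/
theorem splice_sliceSite_zero_zero {G : Type*} (U Y : GaugeConfig 4 (n + 1) G) (y : Fin 3 → ZMod (n + 1)) :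
    LatticeRP.splice WilsonOddRP.lowerEdges (U, Y) (sliceSite 0 y, 0) = Y (sliceSite 0 y, 0) :=
  WilsonOddRP.splice_apply_of_isLowerCross U Y ((isLowerCross_sliceSite_iff 0 y 0).2 ⟨rfl, rfl⟩)

/-! ## Slice blocks under the split and the splice -/


/-- The spatial blocks `a_t, b_t` of two fields with the same spatial slice links agree (private
copy of the lemma of part 4, `FineWeight.sliceDiag_sliceOff_congr`). -/
private theorem sliceDiag_sliceOff_congr₃ {U V : GaugeConfig 4 (n + 1) (Matrix.specialUnitaryGroup (Fin N) ℂ)}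
    {t : Fin (n + 1)} (hUV : ∀ (y : Fin 3 → ZMod (n + 1)) (j : Fin 3), U (sliceSite t y, j.succ) = V (sliceSite t y, j.succ))
    (m : ℝ) :
    sliceDiag (unitaryFundamentalRep (Fin N) ℂ) (apLift U) m t = sliceDiag (unitaryFundamentalRep (Fin N) ℂ) (apLift V) m t ∧
      sliceOff (unitaryFundamentalRep (Fin N) ℂ) (apLift U) t = sliceOff (unitaryFundamentalRep (Fin N) ℂ) (apLift V) t := by
  have h1 : ∀ j, sliceHop (unitaryFundamentalRep (Fin N) ℂ) (apLift U) t j =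
      sliceHop (unitaryFundamentalRep (Fin N) ℂ) (apLift V) t j := fun j => by
    ext p q; simp only [sliceHop, Matrix.of_apply, apLift_sliceSite_succ, unitaryLift_apply, hUV]
  have h2 : ∀ j, sliceHop' (unitaryFundamentalRep (Fin N) ℂ) (apLift U) t j =
      sliceHop' (unitaryFundamentalRep (Fin N) ℂ) (apLift V) t j := fun j => by
    ext p q; simp only [sliceHop', Matrix.of_apply, apLift_sliceSite_succ, unitaryLift_apply, hUV]
  exact ⟨by simp only [sliceDiag, h1, h2], by simp only [sliceOff, h1, h2]⟩

/-- The temporal blocks of two fields with the same temporal links of the layer `t` agree (private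
copy of the lemma of part 4, `FineWeight.sliceLink_congr`). -/
private theorem sliceLink_congr₃ {U V : GaugeConfig 4 (n + 1) (Matrix.specialUnitaryGroup (Fin N) ℂ)} {t : Fin (n + 1)}
    (hUV : ∀ y : Fin 3 → ZMod (n + 1), U (sliceSite t y, 0) = V (sliceSite t y, 0)) :
    sliceLink (unitaryFundamentalRep (Fin N) ℂ) (unitaryLift U) t =
      sliceLink (unitaryFundamentalRep (Fin N) ℂ) (unitaryLift V) t := by
  ext ⟨⟨y, a⟩, k⟩ ⟨⟨y', b⟩, k'⟩
  simp only [sliceLink_apply, unitaryLift_apply, hUV]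

/-- The temporal block of a layer on which the field is a pointwise product is the product of the
temporal blocks (`ρ` is multiplicative and the block is diagonal over the spatial sites). -/
theorem sliceLink_of_mul {U V W : GaugeConfig 4 (n + 1) (Matrix.specialUnitaryGroup (Fin N) ℂ)} {t : Fin (n + 1)}
    (hUVW : ∀ y : Fin 3 → ZMod (n + 1), U (sliceSite t y, 0) = V (sliceSite t y, 0) * W (sliceSite t y, 0)) :
    sliceLink (unitaryFundamentalRep (Fin N) ℂ) (unitaryLift U) t =
      sliceLink (unitaryFundamentalRep (Fin N) ℂ) (unitaryLift V) t *
        sliceLink (unitaryFundamentalRep (Fin N) ℂ) (unitaryLift W) t := by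
  have h : timeLink (unitaryFundamentalRep (Fin N) ℂ) (unitaryLift U) t =
      timeLink (unitaryFundamentalRep (Fin N) ℂ) (unitaryLift V) t *
        timeLink (unitaryFundamentalRep (Fin N) ℂ) (unitaryLift W) t := by
    ext ⟨y, a⟩ ⟨y', b⟩
    simp only [timeLink, Matrix.mul_apply, Matrix.of_apply, Fintype.sum_prod_type, ite_mul, zero_mul,
      Finset.sum_ite_irrel, Finset.sum_const_zero, mul_ite, mul_zero]
    rw [Finset.sum_ite_eq', if_pos (Finset.mem_univ _)]
    by_cases hy : y = y'
    · subst hy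
      simp only [↓reduceIte, unitaryLift_apply, hUVW, map_mul, Matrix.mul_apply]
    · rw [if_neg hy, if_neg hy]
  rw [sliceLink, sliceLink, sliceLink, h, ← Matrix.mul_kronecker_mul, Matrix.mul_one]

/-- The doubled link block is multiplicative. -/
theorem linkBlock_mul {ι : Type*} [Fintype ι] [DecidableEq ι] {R : Type*} [CommRing R] (w w' : Matrix ι ι R) :
    linkBlock (w * w') = linkBlock w * linkBlock w' := by
  simp [linkBlock, Matrix.fromBlocks_multiply]

variable [NeZero N]

/-! ## The transfer-matrix formula on a torus of arbitrary side -/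

/-- **Transfer-matrix formula for `det D_AP[U, m]` on the four-torus of side `n + 1`** (`m > -1`):
`det D_AP[U, m] = (∏ₜ det a_t) · det (1 + Ŵ_nᴴ 𝒴_n ⋯ Ŵ₀ᴴ 𝒴₀)` with the transfer steps
`𝒴_t = transferStep a_t b_t a_t` and the doubled link blocks `Ŵ_t = linkBlock w_t` (the tree's
`fermionDet_wilsonDiracAP_eq_transfer`, there for even sides; same proof). -/
theorem fermionDet_wilsonDiracAP_eq_transfer' (U : GaugeConfig 4 (n + 1) (Matrix.specialUnitaryGroup (Fin N) ℂ))
    {m : ℝ} (hm : -1 < m) :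
    fermionDet (wilsonDiracAP U m) =
      (∏ t, (sliceDiag (unitaryFundamentalRep (Fin N) ℂ) (apLift U) m t).det) *
        (1 + (List.ofFn fun t : Fin (n + 1) =>
          (linkBlock (sliceLink (unitaryFundamentalRep (Fin N) ℂ) (unitaryLift U) t))ᴴ *
            transferStep (sliceDiag (unitaryFundamentalRep (Fin N) ℂ) (apLift U) m t)
              (sliceOff (unitaryFundamentalRep (Fin N) ℂ) (apLift U) t)
              (sliceDiag (unitaryFundamentalRep (Fin N) ℂ) (apLift U) m t)).reverse.prod).det := by
  -- adapted from `Literature.MathematicalPhysics.QuantumLattice.fermionDet_wilsonDiracAP_eq_transfer`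
  rw [fermionDet, wilsonDiracAP_def,
    det_wilsonDirac_eq_det_wilsonBlock _ unitaryFundamentalRep_mem_unitaryGroup, sliceLink_apLift,
    det_wilsonBlock_antiperiodic _ _ _ _
      (fun t => isUnit_iff_ne_zero.2
        (posDef_sliceDiag _ unitaryFundamentalRep_mem_unitaryGroup _ hm t).det_pos.ne')
      (fun t => sliceLink_mul_conjTranspose _ unitaryFundamentalRep_mem_unitaryGroup _ t)]
  simp only [det_sliceLink_unitaryLift, Finset.prod_const_one, mul_one]

/-! ## The Gram identity on the odd torus -/

section Gram

variable {S : ℕ}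

/-- `det a_t` is a positive real number (`m > -1`). -/
theorem det_sliceDiag_pos (U : GaugeConfig 4 (n + 1) (Matrix.specialUnitaryGroup (Fin N) ℂ)) {m : ℝ} (hm : -1 < m)
    (t : Fin (n + 1)) : 0 < (sliceDiag (unitaryFundamentalRep (Fin N) ℂ) (apLift U) m t).det :=
  (posDef_sliceDiag _ unitaryFundamentalRep_mem_unitaryGroup _ hm t).det_pos

/-- `conj det a_t = det a_t`. -/
theorem conj_det_sliceDiag (U : GaugeConfig 4 (n + 1) (Matrix.specialUnitaryGroup (Fin N) ℂ)) {m : ℝ} (hm : -1 < m)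
    (t : Fin (n + 1)) :
    (starRingEnd ℂ) (sliceDiag (unitaryFundamentalRep (Fin N) ℂ) (apLift U) m t).det =
      (sliceDiag (unitaryFundamentalRep (Fin N) ℂ) (apLift U) m t).det :=
  Complex.conj_eq_iff_im.2 (Complex.nonneg_iff.1 (det_sliceDiag_pos U hm t).le).2.symm

/-- **The antiperiodic Wilson fermion determinant on the ODD torus `(ℤ/(2S+1))⁴` is a
reflection-positive Gram kernel for the link reflection `Θ`** (`t ↦ 1 - t`), in the covariant form
of the odd-torus mechanism: after the Osterwalder–Seiler split of the crossing layer `0 → 1`,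
`det D_AP[translateLow Y U, m] = ∑_{q', q} Φ_{q'}(z) · K_{q' q}(U) · conj Φ_q(ΘU)`, `z` the splice
of the crossing links of `Y` into `U`, with the features `Φ_q(V) = c(V) · Ψ_q(𝔊(V))`
(`c(V) = ∏_{1 ≤ s ≤ S} det a_s[V]`, `𝔊(V) = Ŵ_Sᴴ 𝒴_S ⋯ Ŵ₁ᴴ 𝒴₁ Ŵ₀ᴴ` the transfer product of the
positive half including the crossing layer, `Ψ_q` the Cauchy–Binet features `gramFeature`) and the
kernel `K(V) = det a_{S+1}[V] · gramCoupling 1 𝒴_{S+1}[V]` of the shared slice `t = S + 1`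
(`m > -1`, `S ≥ 1`). The slice data are passed as functions with their defining equations. -/
theorem fermionDet_wilsonDiracAP_translateLow_eq_sum_gram (hS : 1 ≤ S)
    (U Y : GaugeConfig 4 (2 * S + 1) (Matrix.specialUnitaryGroup (Fin N) ℂ)) {m : ℝ} (hm : -1 < m)
    (A : GaugeConfig 4 (2 * S + 1) (Matrix.specialUnitaryGroup (Fin N) ℂ) → Fin (2 * S + 1) →
      Matrix (((Fin 3 → ZMod (2 * S + 1)) × Fin N) × Fin 2) (((Fin 3 → ZMod (2 * S + 1)) × Fin N) × Fin 2) ℂ)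
    (hA : ∀ V t, A V t = sliceDiag (unitaryFundamentalRep (Fin N) ℂ) (apLift V) m t)
    (Ys W : GaugeConfig 4 (2 * S + 1) (Matrix.specialUnitaryGroup (Fin N) ℂ) → Fin (2 * S + 1) →
      Matrix ((((Fin 3 → ZMod (2 * S + 1)) × Fin N) × Fin 2) ⊕ (((Fin 3 → ZMod (2 * S + 1)) × Fin N) × Fin 2))
        ((((Fin 3 → ZMod (2 * S + 1)) × Fin N) × Fin 2) ⊕ (((Fin 3 → ZMod (2 * S + 1)) × Fin N) × Fin 2)) ℂ)
    (hYs : ∀ V t, Ys V t = transferStep (A V t) (sliceOff (unitaryFundamentalRep (Fin N) ℂ) (apLift V) t) (A V t))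
    (hW : ∀ V t, W V t = linkBlock (sliceLink (unitaryFundamentalRep (Fin N) ℂ) (unitaryLift V) t))
    (G : GaugeConfig 4 (2 * S + 1) (Matrix.specialUnitaryGroup (Fin N) ℂ) →
      Matrix ((((Fin 3 → ZMod (2 * S + 1)) × Fin N) × Fin 2) ⊕ (((Fin 3 → ZMod (2 * S + 1)) × Fin N) × Fin 2))
        ((((Fin 3 → ZMod (2 * S + 1)) × Fin N) × Fin 2) ⊕ (((Fin 3 → ZMod (2 * S + 1)) × Fin N) × Fin 2)) ℂ)
    (hG : ∀ V, G V = (List.ofFn fun s : Fin (S + 1) =>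
      (W V (Fin.castLE (by omega) s))ᴴ * (if (s : ℕ) = 0 then 1 else Ys V (Fin.castLE (by omega) s))).reverse.prod)
    (c : GaugeConfig 4 (2 * S + 1) (Matrix.specialUnitaryGroup (Fin N) ℂ) → ℂ)
    (hc : ∀ V, c V = ∏ s : Fin S, (A V (Fin.castLE (by omega) s.succ)).det) :
    fermionDet (wilsonDiracAP (WilsonOddRP.translateLow Y U) m) =
      ∑ q', ∑ q, (c (LatticeRP.splice WilsonOddRP.lowerEdges (U, Y)) *
          gramFeature (G (LatticeRP.splice WilsonOddRP.lowerEdges (U, Y))) q') *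
        ((A U ⟨S + 1, by omega⟩).det * gramCoupling 1 (Ys U ⟨S + 1, by omega⟩) q' q) *
        (starRingEnd ℂ) (c U.timeReflect * gramFeature (G U.timeReflect) q) := by
  set z := LatticeRP.splice WilsonOddRP.lowerEdges (U, Y) with hz
  -- slice data of the split field, the splice and the reflection
  have hsp_trans : ∀ t, sliceDiag (unitaryFundamentalRep (Fin N) ℂ) (apLift (WilsonOddRP.translateLow Y U)) m t = A U t ∧
      sliceOff (unitaryFundamentalRep (Fin N) ℂ) (apLift (WilsonOddRP.translateLow Y U)) t =
        sliceOff (unitaryFundamentalRep (Fin N) ℂ) (apLift U) t := fun t => by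
    rw [hA]; exact sliceDiag_sliceOff_congr₃ (fun y j => translateLow_sliceSite_succ Y U t y j) m
  have hsp_z : ∀ t, A z t = A U t ∧
      sliceOff (unitaryFundamentalRep (Fin N) ℂ) (apLift z) t = sliceOff (unitaryFundamentalRep (Fin N) ℂ) (apLift U) t :=
    fun t => by rw [hA, hA]; exact sliceDiag_sliceOff_congr₃ (fun y j => splice_sliceSite_succ U Y t y j) m
  have hYs_z : ∀ t, Ys z t = Ys U t := fun t => by rw [hYs, hYs, (hsp_z t).1, (hsp_z t).2]
  have hA_refl : ∀ t, A U.timeReflect t = A U (1 - t) := fun t => by rw [hA, hA, sliceDiag_timeReflect]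
  have hYs_refl : ∀ t, Ys U.timeReflect t = Ys U (1 - t) := fun t => by
    rw [hYs, hYs, hA_refl, sliceOff_timeReflect]
  have hW_refl : ∀ t, W U.timeReflect t = (W U (-t))ᴴ := fun t => by
    rw [hW, hW, sliceLink_timeReflect, linkBlock, linkBlock, Matrix.fromBlocks_conjTranspose,
      Matrix.conjTranspose_zero]
  have hW_z0 : W z 0 = W Y 0 := by rw [hW, hW, sliceLink_congr₃ (fun y => splice_sliceSite_zero_zero U Y y)]
  have hW_z : ∀ t, t ≠ 0 → W z t = W U t := fun t ht => by
    rw [hW, hW, sliceLink_congr₃ (fun y => splice_sliceSite_zero_of_ne U Y ht y)]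
  have hW_trans0 : linkBlock (sliceLink (unitaryFundamentalRep (Fin N) ℂ) (unitaryLift (WilsonOddRP.translateLow Y U)) 0) =
      W U 0 * W Y 0 := by
    rw [hW, hW, ← linkBlock_mul, sliceLink_of_mul (fun y => translateLow_sliceSite_zero_zero Y U y)]
  have hW_trans : ∀ t, t ≠ 0 →
      linkBlock (sliceLink (unitaryFundamentalRep (Fin N) ℂ) (unitaryLift (WilsonOddRP.translateLow Y U)) t) = W U t :=
    fun t ht => by rw [hW, sliceLink_congr₃ (fun y => translateLow_sliceSite_zero_of_ne Y U ht y)]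
  have hcast0 : ∀ s : Fin (S + 1), (s : ℕ) ≠ 0 → (Fin.castLE (show S + 1 ≤ 2 * S + 1 by omega) s : Fin (2 * S + 1)) ≠ 0 :=
    fun s hs h => hs (by simpa using congrArg Fin.val h)
  have hneg0 : ∀ s : Fin (S + 1), (s : ℕ) ≠ 0 → (-(Fin.castLE (show S + 1 ≤ 2 * S + 1 by omega) s) : Fin (2 * S + 1)) ≠ 0 :=
    fun s hs h => hcast0 s hs (neg_eq_zero.1 h)
  -- the transfer formula for the split field and the odd splitting
  have hHerm : ∀ V t, (Ys V t)ᴴ = Ys V t := fun V t => by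
    rw [hYs, hA]
    exact isHermitian_transferStep (posDef_sliceDiag _ unitaryFundamentalRep_mem_unitaryGroup _ hm _).isHermitian
      (posDef_sliceDiag _ unitaryFundamentalRep_mem_unitaryGroup _ hm _).isHermitian
  rw [fermionDet_wilsonDiracAP_eq_transfer' _ hm]
  simp only [(hsp_trans _).1, (hsp_trans _).2, ← hYs]
  rw [det_one_add_transfer_odd_split S hS
    (fun t => linkBlock (sliceLink (unitaryFundamentalRep (Fin N) ℂ) (unitaryLift (WilsonOddRP.translateLow Y U)) t))
    (Ys U) (W U 0) (W Y 0) (fun s => W z (Fin.castLE (by omega) s)) (fun s => Ys z (Fin.castLE (by omega) s))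
    (fun s => W U.timeReflect (Fin.castLE (by omega) s)) (fun s => Ys U.timeReflect (Fin.castLE (by omega) s))
    (hHerm U) hW_trans0 (by simp only [Fin.castLE_zero, hW_z0])
    (fun s hs => by simp only [hW_z _ (hcast0 s hs), hW_trans _ (hcast0 s hs)])
    (fun s _ => by simp only [hYs_z])
    (by simp only [Fin.castLE_zero, hW_refl, neg_zero])
    (fun s hs => by simp only [hW_refl, hW_trans _ (hneg0 s hs)]) (fun s _ => by simp only [hYs_refl]),
    ← hG z, ← hG U.timeReflect,
    show (G U.timeReflect)ᴴ * Ys U ⟨S + 1, by omega⟩ * G z = (G U.timeReflect)ᴴ * Ys U ⟨S + 1, by omega⟩ * G z * 1 from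
      (Matrix.mul_one _).symm,
    det_one_add_eq_sum_gram _ _ _ _ (by rw [Matrix.det_one]; exact isUnit_one)]
  -- the product of the slice determinants
  have hcz : c z = c U := by
    rw [hc, hc]
    exact Finset.prod_congr rfl fun s _ => by rw [(hsp_z _).1]
  have hcr : c U.timeReflect = ∏ s : Fin S, (A U (1 - Fin.castLE (by omega) s.succ)).det := by
    rw [hc]
    exact Finset.prod_congr rfl fun s _ => by rw [hA_refl]
  have hconj : (starRingEnd ℂ) (c U.timeReflect) = c U.timeReflect := by
    rw [hc, map_prod]
    exact Finset.prod_congr rfl fun s _ => by rw [hA]; exact conj_det_sliceDiag _ hm _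
  rw [prod_odd_circle_split S hS (fun t => (A U t).det), ← hc U, ← hcr, Finset.mul_sum]
  refine Finset.sum_congr rfl fun q' _ => ?_
  rw [Finset.mul_sum]
  refine Finset.sum_congr rfl fun q _ => ?_
  rw [map_mul, hconj, hcz]
  ring

end Gram

section Registered

variable {N : ℕ} [NeZero N]

/-- **Registered sub-goal `stubFW_transfer` of `stub_fineWeightAdmissible`** (clause (6)): Lüscher's
transfer-matrix formula for the antiperiodic Wilson fermion determinant on a four-torus of
ARBITRARY side (the odd sides being the case of the line). -/
theorem stubFW_transfer : ∀ (n : ℕ) (U : GaugeConfig 4 (n + 1) (Matrix.specialUnitaryGroup (Fin N) ℂ)) (m : ℝ), -1 < m →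
    fermionDet (wilsonDiracAP U m) =
      (∏ t, (sliceDiag (unitaryFundamentalRep (Fin N) ℂ) (apLift U) m t).det) *
        (1 + (List.ofFn fun t : Fin (n + 1) =>
          (linkBlock (sliceLink (unitaryFundamentalRep (Fin N) ℂ) (unitaryLift U) t))ᴴ *
            transferStep (sliceDiag (unitaryFundamentalRep (Fin N) ℂ) (apLift U) m t)
              (sliceOff (unitaryFundamentalRep (Fin N) ℂ) (apLift U) t)
              (sliceDiag (unitaryFundamentalRep (Fin N) ℂ) (apLift U) m t)).reverse.prod).det :=
  fun _ U _ hm => fermionDet_wilsonDiracAP_eq_transfer' U hm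

end Registered

end FineWeight

end Summit.QuantumFields.QCD.Cruxes.InterleavedFlowProper.OffsetLastFormatHandover

end
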